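import Literature.NumberTheory.GelbartRogawski1991.LocalDoubledUnitaryDeltaTransport
import Literature.NumberTheory.GelbartRogawski1991.LocalDoubledUnitaryIwahori
import HarnessLib

-- buildfix G11b-3 recipe (LEDGER B13-1/B13-3), as in the GelbartRogawski1991 siblings: elaborate sequentially.
set_option Elab.async false

/-!
# The doubling's Weyl element under the Cayley mover: `ι^𝔻_v(w_Δ) = m(ε)`, and a mover `E″` with `E″ ℓ_Δ = ℓ_Y` and
# `E″ ι^𝔻_v(w_Δ) E″⁻¹ = J_𝕋⁻¹ · m(j)` ([Kudla1994, §3]; [Weil1964, n° 32]; [MoeglinVignerasWaldspurger1987, Chap. 2 II.2])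

Topic `NumberTheory/GelbartRogawski1991`; namespace `Literature.NumberTheory.GelbartRogawski1991.UnitaryDualPair.LocalSplitting`
(sequel of ★ `LocalDoubledUnitaryDeltaTransport` and ★ `LocalDoubledUnitaryIwahori`).  KERNEL only: theorems; no definition, no named fact,
no `sorry`.

SETTING (binders of the local doubled package): `H(F_v) = U(J^𝔻)(F_v)`, `J^𝔻 = gramD F n T₀ = e₂ (T₀ ⊕ −T₀) e₂`, its symplectic realisation
`ι^𝔻_v = iotaD : H(F_v) →* Sp(𝕎^𝔻_v)`, `𝕎^𝔻_v = F_v^{n+n} × F_v^{n+n}` with Gram matrix `𝕋 = localGram F (n+n) (gramD F n T₀) v`, the Lagrangians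
`ℓ_Δ = deltaLagrangian F v n` (both halves agree) and `ℓ_Y = lagrangianY F (n+n) v = 0 × F_v^{n+n}`, and the Weyl element
`w_Δ = weylDelta F E c v n hJD ∈ H(F_v)` (adapted matrix `[[0, 1], [1, 0]]`: it swaps `Δ` and `Δ⁻`).

* §1 `matA_weylDelta`: the matrix of `w_Δ` over `E ⊗ F_v` is `1 ⊕ (−1)` (`= cayR · [[0,1],[1,0]] · cayR⁻¹`); hence
  **`iotaD_weylDelta_eq_transportSp_levi`: `ι^𝔻_v(w_Δ) = transportSp 𝕋 (m(ε))`** for every `ε ∈ GL_{n+n}(F_v)` with matrix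
  `e₂ (1 ⊕ (−1)) e₂` — the Weyl element of the doubled unitary group is a Siegel LEVI element of `Sp(𝕎^𝔻_v)` in the `𝕏 ∕ 𝕐` frame
  (it is `F`-rational and commutes with `𝕋`).
* §2 `map_transportSp_cayleyMover_deltaLagrangian`: the Cayley mover `κ` (§0′; named packaging `Weil1964.DoublingCayleyMover`, filed separately), re-indexed by `e₂ ⊕ e₂` and
  transported to `Sp(𝕎^𝔻_v)`, carries `ℓ_Δ` ONTO `ℓ_Y` (★ `map_transportSp_deltaDiag_deltaLagrangian` verbatim with `cayleyMoverMatrix_mulVec_diag`).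
* §3 `transportSp_cayleyMover_conj_iotaD_weylDelta`: for such a transported `E″ = transportSp 𝕋 A`,
  `E″ · ι^𝔻_v(w_Δ) · E″⁻¹ = (transportSp 𝕋 J)⁻¹ · transportSp 𝕋 (m(j))`, `j = e₂ [[0, −1], [1, 0]] e₂` (`J_mul_doublingCayley_mul_sign`
  transported along the homomorphism `transportSp 𝕋`), and the binder-free package
  **`exists_mover_conj_iotaD_weylDelta`: `∃ E″ B′, ℓ_Δ.map E″ = ℓ_Y ∧ E″ ι^𝔻_v(w_Δ) E″⁻¹ = (transportSp 𝕋 J)⁻¹ * transportSp 𝕋 (levi B′)`** —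
  LITERALLY the hypothesis `hW` of ★ `LocalSchrodingerWeylFourierTwin.implementer_apply_eq_smul_conj_fourierOpPi_leviOpPi` ∕
  `…localOmega_apply_eq_smul_conj_fourierOpPi` (mixed word `J_𝕋⁻¹ m(B′)` ⇒ `R Φ = γ • Γ⁻¹ (𝓕 (leviOpPi B′ (Γ Φ)))`), together with the
  mover hypothesis `hE′` of the Siegel-unipotent companions (`LocalDoubledLeraySectionSiegelUnipotent`, `…SiegelUnipotentMover`).

WHY A NEW MOVER.  The rational element `δ` of ★ `LocalDoubledUnitaryDeltaTransport` also carries `ℓ_Δ` onto `ℓ_Y`, but `δ ι(w_Δ) δ⁻¹` lies in the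
Siegel parabolic of `𝕏` (a two-sided big-cell word `n · m · J · n′`); the Cayley mover sends the opposite Lagrangian `Res Δ⁻` to `𝕏` as well, so
the conjugate of `w_Δ` (which swaps `Δ`, `Δ⁻`) swaps `𝕏`, `𝕐` and is the one-sided word `J⁻¹ m(j)`.

Written for line LD2 (`LTC₁` by the soft road; organ (Z) `AnisotropicPlaneCentreTypeVanishes`, plate (GRP-W) «WEYL GROUP SHAPE») of the cell
`hodgecm-mathlib`; count-neutral (`--supports stmt-HodgeConjecture-24832`); nothing here is a claim of [Liu2021].  HONEST LABEL: HC_CM is proved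
only modulo the 7 printed citations (2 remaining: hLiu418 = stmt-HodgeConjecture-24832, h413 = stmt-HodgeConjecture-24833) until rung 0 closes.

## References
* S. S. Kudla, *Splitting metaplectic covers of dual reductive pairs*, Israel J. Math. 87 (1994) 361–401, §3 [Kudla1994].
* A. Weil, *Sur certains groupes d'opérateurs unitaires*, Acta Math. 111 (1964) 143–211, n° 32 [Weil1964].
* C. Mœglin, M.-F. Vignéras, J.-L. Waldspurger, *Correspondances de Howe sur un corps p-adique*, LNM 1291 (1987), Chap. 2 II.2
  [MoeglinVignerasWaldspurger1987].
-/

set_option autoImplicit false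

noncomputable section

open NumberField IsDedekindDomain Matrix
open Literature.RepresentationTheory.HeisenbergGroup Literature.RepresentationTheory.HeisenbergGroup.SymplecticMatrix
open Literature.NumberTheory.Automorphic Literature.NumberTheory.Automorphic.UnitaryGroup
open Literature.NumberTheory.Weil1964 Literature.LinearAlgebra.QuadraticForm

namespace Literature.NumberTheory.GelbartRogawski1991.UnitaryDualPair.LocalSplitting

/-! ## §0 Re-indexing block matrices along `e ⊕ e` -/

section Reindex

variable {α : Type*} {ι κ : Type*} (e : ι ≃ κ)

/-- `e ⊕ e` re-indexes a block matrix blockwise. [cite: Kudla1994, §3] -/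
theorem reindex_sumCongr_fromBlocks (A B C D : Matrix ι ι α) :
    Matrix.reindex (e.sumCongr e) (e.sumCongr e) (Matrix.fromBlocks A B C D) =
      Matrix.fromBlocks (Matrix.reindex e e A) (Matrix.reindex e e B) (Matrix.reindex e e C) (Matrix.reindex e e D) := by
  ext (i | i) (j | j) <;> rfl

/-- a block-diagonal matrix of re-indexed blocks is the re-indexed block-diagonal matrix. [cite: Kudla1994, §3] -/
theorem fromBlocks_reindex_zero_zero_reindex [Zero α] (A D : Matrix ι ι α) :
    Matrix.fromBlocks (Matrix.reindex e e A) 0 0 (Matrix.reindex e e D) =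
      Matrix.reindex (e.sumCongr e) (e.sumCongr e) (Matrix.fromBlocks A 0 0 D) := by
  rw [reindex_sumCongr_fromBlocks]
  rfl

variable [DecidableEq ι] [DecidableEq κ] (R : Type*) [CommRing R]

/-- Mathlib's `J` re-indexes to `J`. [cite: MoeglinVignerasWaldspurger1987, Chap. 2 II.2] -/
theorem reindex_sumCongr_J : Matrix.reindex (e.sumCongr e) (e.sumCongr e) (Matrix.J ι R) = Matrix.J κ R := by
  rw [Matrix.J, Matrix.J, reindex_sumCongr_fromBlocks]
  simp only [Matrix.reindex_apply, Matrix.submatrix_zero, Matrix.submatrix_neg, Pi.zero_apply, Pi.neg_apply, Matrix.submatrix_one_equiv]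

variable [Fintype ι] [Fintype κ]

/-- the `e ⊕ e` re-indexing of a symplectic matrix is symplectic. [cite: MoeglinVignerasWaldspurger1987, Chap. 2 II.2] -/
theorem reindex_sumCongr_mem_symplecticGroup {M : Matrix (ι ⊕ ι) (ι ⊕ ι) R} (hM : M ∈ Matrix.symplecticGroup ι R) :
    Matrix.reindex (e.sumCongr e) (e.sumCongr e) M ∈ Matrix.symplecticGroup κ R := by
  rw [SymplecticGroup.mem_iff] at hM ⊢
  rw [← reindex_sumCongr_J e R, Matrix.reindex_apply, Matrix.reindex_apply, Matrix.transpose_submatrix, Matrix.submatrix_mul_equiv,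
    Matrix.submatrix_mul_equiv, hM]

end Reindex

/-! ## §0′ The Cayley mover matrix `κ` (explicit; the named API `Weil1964.DoublingCayleyMover.cayleyMover` is its packaging) -/

section Cayley

variable (K : Type*) [CommRing K] [Invertible (2 : K)] (ι : Type*) [Fintype ι] [DecidableEq ι]

/-- **the Cayley mover `κ : (X₁, X₂; Y₁, Y₂) ↦ (X₁ − X₂, ½(Y₁ + Y₂); ½(Y₁ − Y₂), −(X₁ + X₂))` is symplectic** (Mathlib's block
criterion). [cite: Kudla1994, §3] -/
theorem doublingCayley_mem :
    (Matrix.fromBlocks (Matrix.fromBlocks 1 (-1) 0 0) (Matrix.fromBlocks 0 0 ((⅟(2 : K)) • 1) ((⅟(2 : K)) • 1))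
        (Matrix.fromBlocks 0 0 (-1) (-1)) (Matrix.fromBlocks ((⅟(2 : K)) • 1) (-((⅟(2 : K)) • 1)) 0 0) :
      Matrix ((ι ⊕ ι) ⊕ (ι ⊕ ι)) ((ι ⊕ ι) ⊕ (ι ⊕ ι)) K) ∈ Matrix.symplecticGroup (ι ⊕ ι) K := by
  rw [SymplecticGroup.fromBlocks_mem_iff]
  have h2 : (⅟(2 : K)) • (1 : Matrix ι ι K) + (⅟(2 : K)) • (1 : Matrix ι ι K) = 1 := by
    rw [← add_smul, ← two_mul, mul_invOf_self, one_smul]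
  refine ⟨?_, ?_, ?_⟩
  · simp [Matrix.fromBlocks_transpose, Matrix.fromBlocks_multiply]
  · simp [Matrix.fromBlocks_transpose, Matrix.fromBlocks_multiply]
  · simp only [Matrix.fromBlocks_transpose, Matrix.fromBlocks_multiply, Matrix.transpose_one, Matrix.transpose_zero,
      Matrix.transpose_neg, Matrix.mul_one, Matrix.mul_zero, Matrix.mul_neg, add_zero, zero_add, Matrix.mul_smul,
      sub_eq_add_neg, Matrix.fromBlocks_neg, Matrix.fromBlocks_add, smul_neg, neg_neg, neg_add_cancel, h2, Matrix.fromBlocks_one]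

variable {K ι} in
/-- `κ ((a, a); (c, −c)) = (0; (c, −2a))`: the Cayley mover carries the diagonal `W^Δ` into `𝕐 = {X = 0}`. [cite: Kudla1994, §3] -/
theorem doublingCayley_mulVec_diag (a c : ι → K) :
    (Matrix.fromBlocks (Matrix.fromBlocks 1 (-1) 0 0) (Matrix.fromBlocks 0 0 ((⅟(2 : K)) • 1) ((⅟(2 : K)) • 1))
        (Matrix.fromBlocks 0 0 (-1) (-1)) (Matrix.fromBlocks ((⅟(2 : K)) • 1) (-((⅟(2 : K)) • 1)) 0 0) :
      Matrix ((ι ⊕ ι) ⊕ (ι ⊕ ι)) ((ι ⊕ ι) ⊕ (ι ⊕ ι)) K) *ᵥ Sum.elim (Sum.elim a a) (Sum.elim c (-c)) =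
      Sum.elim (0 : ι ⊕ ι → K) (Sum.elim c (-((2 : K) • a))) := by
  have hh : ∀ x : ι → K, (⅟(2 : K)) • x + (⅟(2 : K)) • x = x := fun x => by
    rw [← add_smul, ← two_mul, mul_invOf_self, one_smul]
  simp only [Matrix.fromBlocks_mulVec, Sum.elim_comp_inl, Sum.elim_comp_inr, Matrix.one_mulVec, Matrix.neg_mulVec, Matrix.zero_mulVec,
    Matrix.smul_mulVec, add_zero, smul_neg, add_neg_cancel, neg_neg, hh, two_smul, neg_add]
  funext i
  rcases i with (i | i) | (i | i) <;> simp only [Sum.elim_inl, Sum.elim_inr, Pi.add_apply, Pi.zero_apply, add_zero, zero_add]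

/-- **`J · κ · (ε ⊕ ε) = (j ⊕ j) · κ`** with `ε = 1 ⊕ (−1)` (the doubling's Weyl element `m(ε)`) and the quarter turn `j = [[0, −1], [1, 0]]`:
the conjugate `κ m(ε) κ⁻¹` is the one-sided big-cell word `J⁻¹ m(j)`. [cite: Kudla1994, §3; MoeglinVignerasWaldspurger1987, Chap. 2 II.2] -/
theorem J_mul_doublingCayley_mul_sign :
    Matrix.J (ι ⊕ ι) K * (Matrix.fromBlocks (Matrix.fromBlocks 1 (-1) 0 0) (Matrix.fromBlocks 0 0 ((⅟(2 : K)) • 1) ((⅟(2 : K)) • 1))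
        (Matrix.fromBlocks 0 0 (-1) (-1)) (Matrix.fromBlocks ((⅟(2 : K)) • 1) (-((⅟(2 : K)) • 1)) 0 0) :
      Matrix ((ι ⊕ ι) ⊕ (ι ⊕ ι)) ((ι ⊕ ι) ⊕ (ι ⊕ ι)) K) *
        Matrix.fromBlocks (Matrix.fromBlocks 1 0 0 (-1)) 0 0 (Matrix.fromBlocks 1 0 0 (-1) : Matrix (ι ⊕ ι) (ι ⊕ ι) K) =
      Matrix.fromBlocks (Matrix.fromBlocks 0 (-1) 1 0) 0 0 (Matrix.fromBlocks 0 (-1) 1 0 : Matrix (ι ⊕ ι) (ι ⊕ ι) K) *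
        (Matrix.fromBlocks (Matrix.fromBlocks 1 (-1) 0 0) (Matrix.fromBlocks 0 0 ((⅟(2 : K)) • 1) ((⅟(2 : K)) • 1))
        (Matrix.fromBlocks 0 0 (-1) (-1)) (Matrix.fromBlocks ((⅟(2 : K)) • 1) (-((⅟(2 : K)) • 1)) 0 0) :
      Matrix ((ι ⊕ ι) ⊕ (ι ⊕ ι)) ((ι ⊕ ι) ⊕ (ι ⊕ ι)) K) := by
  simp only [Matrix.J, Matrix.fromBlocks_multiply, Matrix.mul_one, Matrix.one_mul, Matrix.mul_zero, Matrix.zero_mul, Matrix.mul_neg,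
    Matrix.neg_mul, Matrix.mul_smul, Matrix.fromBlocks_neg, neg_neg, neg_zero, smul_zero, add_zero, zero_add, smul_neg]

end Cayley

variable (F : Type) [Field F] [NumberField F] (E : Type) [Field E] [NumberField E] [Algebra F E]
  [Algebra.IsQuadraticExtension F E] (c : E ≃ₐ[F] E)
  {δ : E} (hcδ : c δ = -δ) (hδ : δ ≠ 0) {d : F} (hd : δ * δ = algebraMap F E d)
  (v : HeightOneSpectrum (𝓞 F)) (n : ℕ) {T₀ : Matrix (Fin n) (Fin n) F} (hT₀ : T₀.IsSymm) (hT₀d : IsUnit T₀.det)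
  {JD : Matrix (Fin (n + n)) (Fin (n + n)) E} (hJD : JD = (gramD F n T₀).map (algebraMap F E))

/-! ## §1 `ι^𝔻_v(w_Δ)` is the Siegel Levi element `m(ε)`, `ε = e₂ (1 ⊕ (−1)) e₂` -/

omit [Algebra.IsQuadraticExtension F E] in
include hJD in
/-- **the matrix of `w_Δ` over `E ⊗ F_v` is `1 ⊕ (−1)`**: `cayR · [[0,1],[1,0]] · cayR⁻¹ = [[1,0],[0,−1]]`. [cite: Kudla1994, §3] -/
theorem matA_weylDelta : matA F E c v n (weylDelta F E c v n hJD (T₀ := T₀)) = Matrix.fromBlocks 1 0 0 (-1) := by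
  rw [weylDelta, matA_ofAdapted, AdaptedBlocks.cayRinv, Matrix.mul_smul, AdaptedBlocks.cayR]
  have h2 : (⅟(2 : LocalRing E v)) • ((1 : Matrix (Fin n) (Fin n) (LocalRing E v)) + 1) = 1 := by
    rw [← two_smul (LocalRing E v), smul_smul, invOf_mul_self, one_smul]
  have h2' : (⅟(2 : LocalRing E v)) • (-(1 : Matrix (Fin n) (Fin n) (LocalRing E v)) + -1) = -1 := by
    rw [← neg_add, smul_neg, h2]
  simp only [Matrix.fromBlocks_multiply, Matrix.mul_one, Matrix.mul_zero, Matrix.mul_neg, zero_add, add_zero, add_neg_cancel,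
    neg_add_cancel, Matrix.fromBlocks_smul, smul_zero, h2, h2']

include hT₀ hJD in
/-- **`ι^𝔻_v(w_Δ) = transportSp 𝕋 (m(ε))`** for every `ε ∈ GL_{n+n}(F_v)` with matrix `e₂ (1 ⊕ (−1)) e₂`: in the frame `eD` the Weyl element acts by
the `F`-rational sign matrix on both Darboux coordinates, which is the Siegel Levi element `m(ε)` (`ε = ε⁻ᵀ` commutes with `𝕋 = e₂ (T₀ ⊕ −T₀) e₂`).
[cite: Kudla1994, §3; Weil1964, n° 32] -/
theorem iotaD_weylDelta_eq_transportSp_levi (hTv : IsUnit (localGram F (n + n) (gramD F n T₀) v).det)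
    (ε : GL (Fin (n + n)) (v.adicCompletion F))
    (hε : (ε : Matrix (Fin (n + n)) (Fin (n + n)) (v.adicCompletion F)) =
      Matrix.reindex (e₂ n) (e₂ n) (Matrix.fromBlocks 1 0 0 (-1))) :
    iotaD F E c hcδ hδ hd v n hT₀ hJD (weylDelta F E c v n hJD) =
      transportSp (localGram F (n + n) (gramD F n T₀) v) hTv (levi ε) := by
  -- `ε² = 1`, `ε⁻¹ = ε = εᵀ`, `ε 𝕋 = 𝕋 ε`
  have hεε : (ε : Matrix (Fin (n + n)) (Fin (n + n)) (v.adicCompletion F)) * ε = 1 := by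
    rw [hε, Matrix.reindex_apply, Matrix.submatrix_mul_equiv, Matrix.fromBlocks_multiply]
    simp only [Matrix.mul_one, Matrix.mul_zero, Matrix.mul_neg, neg_neg, neg_zero, add_zero, zero_add, Matrix.fromBlocks_one,
      Matrix.submatrix_one_equiv]
  have hεinv : ((ε⁻¹ : GL (Fin (n + n)) (v.adicCompletion F)) : Matrix (Fin (n + n)) (Fin (n + n)) (v.adicCompletion F)) = ε :=
    Units.inv_eq_of_mul_eq_one_right hεε
  have hεT : (ε : Matrix (Fin (n + n)) (Fin (n + n)) (v.adicCompletion F))ᵀ = ε := by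
    rw [hε, Matrix.transpose_reindex, Matrix.fromBlocks_transpose, Matrix.transpose_one, Matrix.transpose_zero,
      Matrix.transpose_neg, Matrix.transpose_one]
  have hεG : (ε : Matrix (Fin (n + n)) (Fin (n + n)) (v.adicCompletion F)) * localGram F (n + n) (gramD F n T₀) v =
      localGram F (n + n) (gramD F n T₀) v * ε := by
    rw [localGram_gramD, hε, Matrix.reindex_apply, Matrix.reindex_apply, Matrix.submatrix_mul_equiv, Matrix.submatrix_mul_equiv,
      Matrix.fromBlocks_multiply, Matrix.fromBlocks_multiply]
    simp only [Matrix.mul_one, Matrix.one_mul, Matrix.mul_zero, Matrix.zero_mul, Matrix.mul_neg, Matrix.neg_mul, add_zero, zero_add]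
  -- the sign matrix over `E ⊗ F_v` acts by `(u₁, u₂) ↦ (u₁, −u₂)`
  have hRu : ∀ u : Fin n ⊕ Fin n → LocalRing E v,
      Matrix.fromBlocks (1 : Matrix (Fin n) (Fin n) (LocalRing E v)) 0 0 (-1) *ᵥ u = Sum.elim (u ∘ Sum.inl) (-(u ∘ Sum.inr)) := fun u => by
    rw [Matrix.fromBlocks_mulVec, Matrix.one_mulVec, Matrix.zero_mulVec, Matrix.zero_mulVec, Matrix.neg_mulVec, Matrix.one_mulVec,
      add_zero, zero_add]
  have hRx : ∀ x : Fin (n + n) → v.adicCompletion F,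
      (ε : Matrix (Fin (n + n)) (Fin (n + n)) (v.adicCompletion F)) *ᵥ x =
        (Sum.elim (x ∘ e₂ n ∘ Sum.inl) (-(x ∘ e₂ n ∘ Sum.inr))) ∘ (e₂ n).symm := fun x => by
    rw [hε, Matrix.reindex_apply, Matrix.submatrix_mulVec_equiv, Equiv.symm_symm, Matrix.fromBlocks_mulVec, Matrix.one_mulVec,
      Matrix.zero_mulVec, Matrix.zero_mulVec, Matrix.neg_mulVec, Matrix.one_mulVec, add_zero, zero_add]
    rfl
  -- compare on `w = eD u`
  apply Subtype.ext
  apply LinearEquiv.ext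
  intro w
  obtain ⟨u, rfl⟩ := (eD F E c hcδ hδ hd v n).surjective w
  have hL := eD_matA_mulVec F E c hcδ hδ hd v n hT₀ hJD (weylDelta F E c v n hJD) u
  rw [matA_weylDelta F E c v n hJD, hRu, LinearEquiv.coe_coe] at hL
  rw [← hL, coe_transportSp_apply, coe_levi, hεinv, hεT, SymplecticMatrix.darboux_apply, Matrix.fromBlocks_mulVec, Sum.elim_comp_inl,
    Sum.elim_comp_inr, Matrix.zero_mulVec, Matrix.zero_mulVec, add_zero, zero_add, SymplecticMatrix.darboux_symm_sumElim,
    Matrix.mulVec_mulVec, Matrix.mulVec_mulVec, Matrix.mul_assoc, hεG, ← Matrix.mul_assoc, Matrix.nonsing_inv_mul _ hTv,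
    Matrix.one_mul, hRx, hRx, eD_apply, eD_apply]
  refine Prod.ext (funext fun k => ?_) (funext fun k => ?_)
  · obtain ⟨s, rfl⟩ := (e₂ n).surjective k
    rcases s with i | i <;>
      simp only [localReImD, QuadraticCoordinates.reIm_apply_fst, Function.comp_apply, Equiv.symm_apply_apply, Sum.elim_inl, Sum.elim_inr, Pi.neg_apply,
        map_neg]
  · obtain ⟨s, rfl⟩ := (e₂ n).surjective k
    rcases s with i | i <;>
      simp only [localReImD, QuadraticCoordinates.reIm_apply_snd, Function.comp_apply, Equiv.symm_apply_apply, Sum.elim_inl, Sum.elim_inr, Pi.neg_apply,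
        map_neg]

/-! ## §2 The Cayley mover carries `ℓ_Δ` onto `ℓ_Y` -/

omit [NumberField E] [Algebra.IsQuadraticExtension F E] in
include hT₀d in
/-- **`κ ℓ_Δ = ℓ_Y`**: the re-indexed Cayley mover `κ = cayleyMoverMatrix`, transported to `Sp(𝕎^𝔻_v)` along the Darboux coordinates of `𝕋`,
carries `ℓ_Δ = Res Δ` onto `ℓ_Y = 0 × F_v^{n+n}` (on a diagonal point the Darboux `Y`-coordinate is `(T₀ y, −T₀ y)` and
`κ ((a, a); (c, −c)) = (0; (c, −2a))`; equality by dimension). [cite: Kudla1994, §3] -/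
theorem map_transportSp_cayleyMover_deltaLagrangian [Invertible (2 : v.adicCompletion F)]
    (hTv : IsUnit (localGram F (n + n) (gramD F n T₀) v).det)
    (A : Matrix.symplecticGroup (Fin (n + n)) (v.adicCompletion F))
    (hA : (A : Matrix (Fin (n + n) ⊕ Fin (n + n)) (Fin (n + n) ⊕ Fin (n + n)) (v.adicCompletion F)) =
      Matrix.reindex ((e₂ n).sumCongr (e₂ n)) ((e₂ n).sumCongr (e₂ n))
        (Matrix.fromBlocks (Matrix.fromBlocks 1 (-1) 0 0)
            (Matrix.fromBlocks 0 0 ((⅟(2 : v.adicCompletion F)) • 1) ((⅟(2 : v.adicCompletion F)) • 1))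
            (Matrix.fromBlocks 0 0 (-1) (-1)) (Matrix.fromBlocks ((⅟(2 : v.adicCompletion F)) • 1) (-((⅟(2 : v.adicCompletion F)) • 1)) 0 0) :
          Matrix ((Fin n ⊕ Fin n) ⊕ (Fin n ⊕ Fin n)) ((Fin n ⊕ Fin n) ⊕ (Fin n ⊕ Fin n)) (v.adicCompletion F))) :
    (deltaLagrangian F v n).map (toLin F v (transportSp (localGram F (n + n) (gramD F n T₀) v) hTv A)) =
      lagrangianY F (n + n) v := by
  -- (≤): the `X`-coordinate of `κ p` vanishes for `p ∈ ℓ_Δ`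
  have hle : (deltaLagrangian F v n).map (toLin F v (transportSp (localGram F (n + n) (gramD F n T₀) v) hTv A)) ≤
      lagrangianY F (n + n) v := by
    rintro _ ⟨p, hp, rfl⟩
    rw [lagrangianY, Submodule.mem_prod]
    refine ⟨?_, Submodule.mem_top⟩
    rw [Submodule.mem_bot]
    change (((transportSp (localGram F (n + n) (gramD F n T₀) v) hTv A :
        symplecticGroup (polar (localPairing F (n + n) (gramD F n T₀) v))) :
          ((Fin (n + n) → (v.adicCompletion F)) × (Fin (n + n) → (v.adicCompletion F))) ≃ₗ[(v.adicCompletion F)]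
            ((Fin (n + n) → (v.adicCompletion F)) × (Fin (n + n) → (v.adicCompletion F)))) p).1 = 0
    rw [coe_transportSp_apply, SymplecticMatrix.darboux_symm_apply]
    dsimp only
    -- the halves of `p`
    obtain ⟨x, hx⟩ : ∃ x : Fin n → (v.adicCompletion F), p.1 ∘ (e₂ n) = Sum.elim x x :=
      ⟨fun i => p.1 (e₂ n (Sum.inl i)), funext fun s => by
        rcases s with i | i
        · rfl
        · exact ((hp i).1).symm⟩
    obtain ⟨y, hy⟩ : ∃ y : Fin n → (v.adicCompletion F), p.2 ∘ (e₂ n) = Sum.elim y y :=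
      ⟨fun i => p.2 (e₂ n (Sum.inl i)), funext fun s => by
        rcases s with i | i
        · rfl
        · exact ((hp i).2).symm⟩
    -- the Darboux `Y`-coordinate `T p.2 = e₂ (T₀ y, -T₀ y)`
    have hTy : (localGram F (n + n) (gramD F n T₀) v *ᵥ p.2) ∘ (e₂ n) =
        Sum.elim (T₀.map (algebraMap F (v.adicCompletion F)) *ᵥ y) (-(T₀.map (algebraMap F (v.adicCompletion F)) *ᵥ y)) := by
      rw [localGram_gramD, Matrix.reindex_apply, Matrix.submatrix_mulVec_equiv, Function.comp_assoc, Equiv.symm_comp_self,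
        Function.comp_id, Equiv.symm_symm, hy, Matrix.fromBlocks_mulVec, Matrix.zero_mulVec, Matrix.zero_mulVec, Matrix.neg_mulVec,
        add_zero, zero_add, Sum.elim_comp_inl, Sum.elim_comp_inr]
    -- `A (darboux p) = (e₂ ⊕ e₂) (κ ((x, x); (T₀ y, -T₀ y))) = (e₂ ⊕ e₂) (0; …)`
    rw [hA, Matrix.reindex_apply, Matrix.submatrix_mulVec_equiv]
    have hu : (Sum.elim p.1 (localGram F (n + n) (gramD F n T₀) v *ᵥ p.2)) ∘ ((e₂ n).sumCongr (e₂ n)) =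
        Sum.elim (Sum.elim x x) (Sum.elim (T₀.map (algebraMap F (v.adicCompletion F)) *ᵥ y)
          (-(T₀.map (algebraMap F (v.adicCompletion F)) *ᵥ y))) := by
      rw [← hx, ← hTy]
      funext s
      rcases s with s | s <;> rfl
    funext k
    rw [Function.comp_apply, Function.comp_apply]
    change ((Matrix.fromBlocks (Matrix.fromBlocks 1 (-1) 0 0)
            (Matrix.fromBlocks 0 0 ((⅟(2 : v.adicCompletion F)) • 1) ((⅟(2 : v.adicCompletion F)) • 1))
            (Matrix.fromBlocks 0 0 (-1) (-1)) (Matrix.fromBlocks ((⅟(2 : v.adicCompletion F)) • 1) (-((⅟(2 : v.adicCompletion F)) • 1)) 0 0) :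
          Matrix ((Fin n ⊕ Fin n) ⊕ (Fin n ⊕ Fin n)) ((Fin n ⊕ Fin n) ⊕ (Fin n ⊕ Fin n)) (v.adicCompletion F)) *ᵥ
        ((Sum.elim p.1 (localGram F (n + n) (gramD F n T₀) v *ᵥ p.2)) ∘ ((e₂ n).sumCongr (e₂ n))))
        (((e₂ n).sumCongr (e₂ n)).symm (Sum.inl k)) = 0
    rw [hu, doublingCayley_mulVec_diag, Equiv.sumCongr_symm, Equiv.sumCongr_apply, Sum.map_inl, Sum.elim_inl, Pi.zero_apply]
  -- equality by dimension: `ℓ_Δ` and `ℓ_Y` are conjugate Lagrangians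
  refine Submodule.eq_of_le_of_finrank_eq hle ?_
  rw [LinearEquiv.finrank_map_eq]
  obtain ⟨g, hg⟩ := exists_isometries_map_eq (isAlt_alt_polar F (n + n) (gramD F n T₀) v)
    (nondegenerate_alt_polar F (n + n) (gramD F n T₀) v (isUnit_det_gramD F n hT₀d))
    (deltaLagrangian_orthogonal F v n T₀ hT₀d) (orthogonal_lagrangianY F (n + n) (gramD F n T₀) v (isUnit_det_gramD F n hT₀d))
  rw [← hg, LinearEquiv.finrank_map_eq]

/-! ## §3 The conjugated Weyl element: `E″ ι^𝔻_v(w_Δ) E″⁻¹ = J_𝕋⁻¹ · m(j)` -/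

include hT₀ hJD in
/-- **`E″ · ι^𝔻_v(w_Δ) · E″⁻¹ = (transportSp 𝕋 J)⁻¹ · transportSp 𝕋 (m(j))`** for `E″ = transportSp 𝕋 A`, `A` the re-indexed Cayley mover and
`j ∈ GL_{n+n}(F_v)` the re-indexed quarter turn `e₂ [[0, −1], [1, 0]] e₂` (`J_mul_doublingCayley_mul_sign` read on vectors). [cite: Kudla1994, §3; MoeglinVignerasWaldspurger1987, Chap. 2 II.2] -/
theorem transportSp_cayleyMover_conj_iotaD_weylDelta [Invertible (2 : v.adicCompletion F)]
    (hTv : IsUnit (localGram F (n + n) (gramD F n T₀) v).det)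
    (A : Matrix.symplecticGroup (Fin (n + n)) (v.adicCompletion F))
    (hA : (A : Matrix (Fin (n + n) ⊕ Fin (n + n)) (Fin (n + n) ⊕ Fin (n + n)) (v.adicCompletion F)) =
      Matrix.reindex ((e₂ n).sumCongr (e₂ n)) ((e₂ n).sumCongr (e₂ n))
        (Matrix.fromBlocks (Matrix.fromBlocks 1 (-1) 0 0)
            (Matrix.fromBlocks 0 0 ((⅟(2 : v.adicCompletion F)) • 1) ((⅟(2 : v.adicCompletion F)) • 1))
            (Matrix.fromBlocks 0 0 (-1) (-1)) (Matrix.fromBlocks ((⅟(2 : v.adicCompletion F)) • 1) (-((⅟(2 : v.adicCompletion F)) • 1)) 0 0) :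
          Matrix ((Fin n ⊕ Fin n) ⊕ (Fin n ⊕ Fin n)) ((Fin n ⊕ Fin n) ⊕ (Fin n ⊕ Fin n)) (v.adicCompletion F)))
    (j : GL (Fin (n + n)) (v.adicCompletion F))
    (hj : (j : Matrix (Fin (n + n)) (Fin (n + n)) (v.adicCompletion F)) = Matrix.reindex (e₂ n) (e₂ n) (Matrix.fromBlocks 0 (-1) 1 0)) :
    transportSp (localGram F (n + n) (gramD F n T₀) v) hTv A * iotaD F E c hcδ hδ hd v n hT₀ hJD (weylDelta F E c v n hJD) *
        (transportSp (localGram F (n + n) (gramD F n T₀) v) hTv A)⁻¹ =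
      (transportSp (localGram F (n + n) (gramD F n T₀) v) hTv (SymplecticGroup.symJ _ _))⁻¹ *
        transportSp (localGram F (n + n) (gramD F n T₀) v) hTv (levi j) := by
  -- the sign element `ε` (`ε⁻¹ = ε = εᵀ`)
  have hεε : Matrix.reindex (e₂ n) (e₂ n) (Matrix.fromBlocks 1 0 0 (-1) : Matrix (Fin n ⊕ Fin n) (Fin n ⊕ Fin n) (v.adicCompletion F)) *
      Matrix.reindex (e₂ n) (e₂ n) (Matrix.fromBlocks 1 0 0 (-1)) = 1 := by
    rw [Matrix.reindex_apply, Matrix.submatrix_mul_equiv, Matrix.fromBlocks_multiply]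
    simp only [Matrix.mul_one, Matrix.mul_zero, Matrix.mul_neg, neg_neg, neg_zero, add_zero, zero_add, Matrix.fromBlocks_one,
      Matrix.submatrix_one_equiv]
  obtain ⟨ε, hε⟩ : ∃ ε : GL (Fin (n + n)) (v.adicCompletion F),
      (ε : Matrix (Fin (n + n)) (Fin (n + n)) (v.adicCompletion F)) = Matrix.reindex (e₂ n) (e₂ n) (Matrix.fromBlocks 1 0 0 (-1)) :=
    ⟨⟨_, _, hεε, hεε⟩, rfl⟩
  have hεinvT : ((ε⁻¹ : GL (Fin (n + n)) (v.adicCompletion F)) : Matrix (Fin (n + n)) (Fin (n + n)) (v.adicCompletion F))ᵀ =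
      Matrix.reindex (e₂ n) (e₂ n) (Matrix.fromBlocks 1 0 0 (-1)) := by
    rw [Units.inv_eq_of_mul_eq_one_right (show (ε : Matrix (Fin (n + n)) (Fin (n + n)) (v.adicCompletion F)) *
      Matrix.reindex (e₂ n) (e₂ n) (Matrix.fromBlocks 1 0 0 (-1)) = 1 by rw [hε, hεε])]
    simp only [Matrix.transpose_reindex, Matrix.fromBlocks_transpose, Matrix.transpose_one, Matrix.transpose_zero, Matrix.transpose_neg]
  -- the quarter turn `j` (`j⁻¹ = jᵀ`)
  have hjj : (j : Matrix (Fin (n + n)) (Fin (n + n)) (v.adicCompletion F)) * Matrix.reindex (e₂ n) (e₂ n) (Matrix.fromBlocks 0 1 (-1) 0) = 1 := by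
    rw [hj, Matrix.reindex_apply, Matrix.reindex_apply, Matrix.submatrix_mul_equiv, Matrix.fromBlocks_multiply]
    simp only [Matrix.mul_one, Matrix.mul_zero, Matrix.mul_neg, neg_neg, neg_zero, add_zero, zero_add, Matrix.fromBlocks_one,
      Matrix.submatrix_one_equiv]
  have hjinvT : ((j⁻¹ : GL (Fin (n + n)) (v.adicCompletion F)) : Matrix (Fin (n + n)) (Fin (n + n)) (v.adicCompletion F))ᵀ =
      Matrix.reindex (e₂ n) (e₂ n) (Matrix.fromBlocks 0 (-1) 1 0) := by
    rw [Units.inv_eq_of_mul_eq_one_right hjj]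
    simp only [Matrix.transpose_reindex, Matrix.fromBlocks_transpose, Matrix.transpose_one, Matrix.transpose_zero, Matrix.transpose_neg]
  -- the matrix identity `J · κ · m(ε) = m(j) · κ`, re-indexed
  have hM : Matrix.J (Fin (n + n)) (v.adicCompletion F) *
        ((A : Matrix (Fin (n + n) ⊕ Fin (n + n)) (Fin (n + n) ⊕ Fin (n + n)) (v.adicCompletion F)) *
          ((levi ε : Matrix.symplecticGroup (Fin (n + n)) (v.adicCompletion F)) :
            Matrix (Fin (n + n) ⊕ Fin (n + n)) (Fin (n + n) ⊕ Fin (n + n)) (v.adicCompletion F))) =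
      ((levi j : Matrix.symplecticGroup (Fin (n + n)) (v.adicCompletion F)) :
          Matrix (Fin (n + n) ⊕ Fin (n + n)) (Fin (n + n) ⊕ Fin (n + n)) (v.adicCompletion F)) *
        (A : Matrix (Fin (n + n) ⊕ Fin (n + n)) (Fin (n + n) ⊕ Fin (n + n)) (v.adicCompletion F)) := by
    rw [coe_levi, coe_levi, hA, hε, hεinvT, hj, hjinvT, fromBlocks_reindex_zero_zero_reindex, fromBlocks_reindex_zero_zero_reindex,
      ← reindex_sumCongr_J (e₂ n) (v.adicCompletion F), Matrix.reindex_apply, Matrix.reindex_apply, Matrix.reindex_apply,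
      Matrix.reindex_apply, Matrix.submatrix_mul_equiv, Matrix.submatrix_mul_equiv, Matrix.submatrix_mul_equiv, ← Matrix.mul_assoc,
      J_mul_doublingCayley_mul_sign]
  -- read on vectors `w = E″ w'` (no group algebra in `Sp_{2(n+n)}(F_v)` is needed)
  rw [iotaD_weylDelta_eq_transportSp_levi F E c hcδ hδ hd v n hT₀ hJD hTv ε hε]
  apply Subtype.ext
  apply LinearEquiv.ext
  intro w
  obtain ⟨w', rfl⟩ := (transportSp (localGram F (n + n) (gramD F n T₀) v) hTv A).1.surjective w
  simp only [Subgroup.coe_mul, Subgroup.coe_inv, LinearEquiv.mul_apply, LinearEquiv.coe_inv, LinearEquiv.symm_apply_apply]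
  rw [LinearEquiv.eq_symm_apply]
  simp only [coe_transportSp_apply, LinearEquiv.apply_symm_apply, Matrix.mulVec_mulVec, SymplecticGroup.coe_J]
  rw [hM]

include hT₀ hT₀d hJD in
/-- **THE WEYL GROUP SHAPE of the doubling's Weyl element** (binder-free package): there are a mover `E″ ∈ Sp(𝕎^𝔻_v)` with `E″ ℓ_Δ = ℓ_Y` and a
`B′ ∈ GL_{n+n}(F_v)` with **`E″ · ι^𝔻_v(w_Δ) · E″⁻¹ = (transportSp 𝕋 J)⁻¹ · transportSp 𝕋 (m(B′))`** — LITERALLY the hypothesis `hW` of the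
Weyl ∕ Fourier operator twin (★ `implementer_apply_eq_smul_conj_fourierOpPi_leviOpPi`: `R Φ = γ • Γ⁻¹ (𝓕 (leviOpPi B′ (Γ Φ)))` for any implementer
`R` of `ι^𝔻_v(w_Δ)` and `Γ` of `E″`), together with the mover hypothesis `hE′` of the Siegel-unipotent companions.  Witnesses: the Cayley mover
and the quarter turn `j`. [cite: Kudla1994, §3; Weil1964, n° 32; MoeglinVignerasWaldspurger1987, Chap. 2 II.2] -/
theorem exists_mover_conj_iotaD_weylDelta (hTv : IsUnit (localGram F (n + n) (gramD F n T₀) v).det) :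
    ∃ (E'' : LocalSp F (n + n) (gramD F n T₀) v) (B' : GL (Fin (n + n)) (v.adicCompletion F)),
      (deltaLagrangian F v n).map (toLin F v E'') = lagrangianY F (n + n) v ∧
      E'' * iotaD F E c hcδ hδ hd v n hT₀ hJD (weylDelta F E c v n hJD) * E''⁻¹ =
        (transportSp (localGram F (n + n) (gramD F n T₀) v) hTv (SymplecticGroup.symJ _ _))⁻¹ *
          transportSp (localGram F (n + n) (gramD F n T₀) v) hTv (levi B') := by
  haveI : CharZero (v.adicCompletion F) := charZero_of_injective_algebraMap (algebraMap F (v.adicCompletion F)).injective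
  haveI : Invertible (2 : v.adicCompletion F) := invertibleOfNonzero two_ne_zero
  have hjj : Matrix.reindex (e₂ n) (e₂ n) (Matrix.fromBlocks 0 (-1) 1 0 : Matrix (Fin n ⊕ Fin n) (Fin n ⊕ Fin n) (v.adicCompletion F)) *
      Matrix.reindex (e₂ n) (e₂ n) (Matrix.fromBlocks 0 1 (-1) 0) = 1 := by
    rw [Matrix.reindex_apply, Matrix.reindex_apply, Matrix.submatrix_mul_equiv, Matrix.fromBlocks_multiply]
    simp only [Matrix.mul_one, Matrix.mul_zero, Matrix.mul_neg, neg_neg, neg_zero, add_zero, zero_add, Matrix.fromBlocks_one,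
      Matrix.submatrix_one_equiv]
  have hjj' : Matrix.reindex (e₂ n) (e₂ n) (Matrix.fromBlocks 0 1 (-1) 0 : Matrix (Fin n ⊕ Fin n) (Fin n ⊕ Fin n) (v.adicCompletion F)) *
      Matrix.reindex (e₂ n) (e₂ n) (Matrix.fromBlocks 0 (-1) 1 0) = 1 := by
    rw [Matrix.reindex_apply, Matrix.reindex_apply, Matrix.submatrix_mul_equiv, Matrix.fromBlocks_multiply]
    simp only [Matrix.mul_one, Matrix.mul_zero, Matrix.mul_neg, neg_neg, neg_zero, add_zero, zero_add, Matrix.fromBlocks_one,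
      Matrix.submatrix_one_equiv]
  refine ⟨transportSp (localGram F (n + n) (gramD F n T₀) v) hTv
      ⟨_, reindex_sumCongr_mem_symplecticGroup (e₂ n) (v.adicCompletion F) (doublingCayley_mem (v.adicCompletion F) (Fin n))⟩,
    ⟨Matrix.reindex (e₂ n) (e₂ n) (Matrix.fromBlocks 0 (-1) 1 0), Matrix.reindex (e₂ n) (e₂ n) (Matrix.fromBlocks 0 1 (-1) 0), hjj, hjj'⟩,
    map_transportSp_cayleyMover_deltaLagrangian F v n hT₀d hTv _ rfl,
    transportSp_cayleyMover_conj_iotaD_weylDelta F E c hcδ hδ hd v n hT₀ hJD hTv _ rfl _ rfl⟩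

end Literature.NumberTheory.GelbartRogawski1991.UnitaryDualPair.LocalSplitting

end
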